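import Summits.AtomisticToContinuum.Crystallization.Theorems.PalmUnimodularRigidityMinimiserShellsGoodShellMeasurable
import Summits.AtomisticToContinuum.Crystallization.Theorems.PalmUnimodularRigidityMinimiserShellsResidualDefs

/-!
# Giry-measurability of the loosened shell event (stub `stub_looseGoodShellMeasurable`)

Stub 2 of line `elastic-coarse-to-fine` (skeleton r5) of crux `MinimiserShells`
(stmt-AtomisticToContinuum-9225, route `PalmUnimodularRigidity`): for every loosening parameter
`θ ≥ 0` there is a measurable set `B` of configurations `μ : Measure ℝ³` (Giry σ-algebra) such that
for every `δ > 0` and every rooted `δ`-hard-core counting measure `μ`, `μ ∈ B ↔ LooseGoodShell θ μ`.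
Here `LooseGoodShell θ` (`…ResidualDefs.lean`) is the crux's `GoodShell` with matching tolerance
`a/100 + θ` and shell radius `(5/4 − θ)·a`.

Proof: the mechanical adaptation of `…GoodShellMeasurable.lean` (the case `θ = 0`), whose
parameter-free lemmas (measurability of the window `𝕎 = {y ≠ 0, ‖y‖ ≤ 5/4}` and of `μ ↦ μ|𝕎`,
compactness of the isometries, projection along a compact factor, matchings from parametrisations)
are reused.  `LooseGoodShell θ (count|S)` only depends on `S ∩ 𝕎` because `(5/4 − θ)·a ≤ 5/4` for
`θ ≥ 0` and `a ≤ 1` (`looseGoodShell_count_restrict_inter_window`; the only use of `0 ≤ θ`).  By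
the transfer theorem `Literature.Probability.PointProcesses.exists_measurableSet_count_restrict_mem_iff`
it suffices that, for every `m`, the loosened shell condition on injective `m`-tuples of window
points is Borel in `Fin m → ℝ³` (`exists_measurableSet_looseGoodShell`).  It is a countable union of
CLOSED sets: the combinatorial data of a matching are discretised — an injective assignment
`g : pat → Fin m` of shell atoms to the points of the pattern `pat ∈ {fcc, hcp}` and a gap parameter
`k` turning the strict inequality `‖y i‖ > (5/4 − θ)a` for unmatched atoms into
`≥ (5/4 − θ)a + 1/(k+1)` (`looseShell_iff_match`) — and the continuous parameters `(a, L)` (scale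
`a ∈ [9/10, 1]`, linear isometry `L`) range over a compact set and are projected out
(`isClosed_looseMatchSet`).  No definitions are introduced.
-/

noncomputable section

open MeasureTheory
open scoped ENNReal BigOperators

namespace Summit.AtomisticToContinuum.Crystallization.Theorems.PalmUnimodularRigidityMinimiserShells.LooseGoodShellMeasurable

open Literature.Probability.Process (IsRootedHardCore count_restrict_singleton_ne_zero_iff)
open Literature.Probability.PointProcesses (exists_measurableSet_count_restrict_mem_iff)
open Literature.MathematicalPhysics.StatisticalMechanics (UniformlyDiscrete)
open Literature.Geometry.DiscreteGeometry (EtaMatched ShellCloseTo fccKissingPattern hcpKissingPattern)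
open Summit.AtomisticToContinuum.Crystallization.Theorems.PalmUnimodularRigidityMinimiserShells.Residual
  (LooseGoodShell)
open Summit.AtomisticToContinuum.Crystallization.Theorems.PalmUnimodularRigidityMinimiserShells.GoodShellMeasurable
  (measurableSet_window measurable_restrict_window measurableSet_forall_mem_window isCompact_iso
    isClosed_setOf_exists_mem_of_isCompact etaMatched_of_param)

/-- Euclidean 3-space (local notation). -/
local notation "E3" => EuclideanSpace ℝ (Fin 3)

/-- The shell window `{y ≠ 0, ‖y‖ ≤ 5/4}` (local notation). -/
local notation3 (prettyPrint := false) "𝕎" => ({y | y ≠ 0 ∧ ‖y‖ ≤ 5 / 4} : Set (EuclideanSpace ℝ (Fin 3)))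

/-! ## The loosened shell predicate on counting measures and the window -/

/-- Unfolding `LooseGoodShell θ` on a counting measure `count|S`: its atoms are the points of `S`. -/
theorem looseGoodShell_count_restrict_iff (θ : ℝ) (S : Set E3) :
    LooseGoodShell θ ((Measure.count : Measure E3).restrict S) ↔
      ∃ a : ℝ, 9 / 10 ≤ a ∧ a ≤ 1 ∧ ∃ T : Finset E3,
        (↑T : Set E3) = {y : E3 | y ∈ S ∧ y ≠ 0 ∧ ‖y‖ ≤ (5 / 4 - θ) * a} ∧
          (ShellCloseTo (a / 100 + θ) T (Finset.image (fun v : E3 => a • v) fccKissingPattern) ∨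
            ShellCloseTo (a / 100 + θ) T (Finset.image (fun v : E3 => a • v) hcpKissingPattern)) := by
  unfold LooseGoodShell
  simp only [count_restrict_singleton_ne_zero_iff]

/-- `LooseGoodShell θ (count|S)` (`θ ≥ 0`) only looks at the window: `S` may be replaced by `𝕎 ∩ S`
(the loosened predicate reads only atoms of norm `≤ (5/4 − θ)·a ≤ 5/4`, as `θ ≥ 0`, `a ≤ 1`). -/
theorem looseGoodShell_count_restrict_inter_window {θ : ℝ} (hθ : 0 ≤ θ) (S : Set E3) :
    LooseGoodShell θ ((Measure.count : Measure E3).restrict (𝕎 ∩ S)) ↔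
      LooseGoodShell θ ((Measure.count : Measure E3).restrict S) := by
  rw [looseGoodShell_count_restrict_iff, looseGoodShell_count_restrict_iff]
  refine exists_congr fun a => and_congr_right fun ha => and_congr_right fun ha' => exists_congr fun T => ?_
  have hrad : ∀ y : E3, ‖y‖ ≤ (5 / 4 - θ) * a → ‖y‖ ≤ 5 / 4 := fun y hy => by
    nlinarith [mul_nonneg hθ (show (0 : ℝ) ≤ a by linarith)]
  have h : {y : E3 | y ∈ 𝕎 ∩ S ∧ y ≠ 0 ∧ ‖y‖ ≤ (5 / 4 - θ) * a} =
      {y : E3 | y ∈ S ∧ y ≠ 0 ∧ ‖y‖ ≤ (5 / 4 - θ) * a} :=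
    Set.ext fun y => ⟨fun ⟨⟨_, hS⟩, hy0, hle⟩ => ⟨hS, hy0, hle⟩,
      fun ⟨hS, hy0, hle⟩ => ⟨⟨⟨hy0, hrad y hle⟩, hS⟩, hy0, hle⟩⟩
  rw [h]

/-! ## The loosened matching relation and the closed sets of matched tuples -/

/-- The loosened matching relation between parameters `(a, L)` and tuples `y` (pattern `pat`,
assignment `g : pat → Fin m`, gap `k`: every pattern point `v` is matched to the shell atom
`y (g v)` — `‖y (g v)‖ ≤ (5/4 − θ)a`, `dist (y (g v)) (L (a • v)) ≤ a/100 + θ` — and every unmatched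
atom has norm `≥ (5/4 − θ)a + 1/(k+1)`) is closed. -/
theorem isClosed_looseMatchRel (θ : ℝ) (m : ℕ) (pat : Finset E3) (g : ↥pat → Fin m) (k : ℕ) :
    IsClosed {r : (ℝ × (E3 →L[ℝ] E3)) × (Fin m → E3) |
      (∀ v : ↥pat, ‖r.2 (g v)‖ ≤ (5 / 4 - θ) * r.1.1 ∧
          dist (r.2 (g v)) (r.1.2 (r.1.1 • (v : E3))) ≤ r.1.1 / 100 + θ) ∧
        ∀ i : Fin m, i ∉ Set.range g → (5 / 4 - θ) * r.1.1 + 1 / ((k : ℝ) + 1) ≤ ‖r.2 i‖} := by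
  simp only [Set.setOf_and, Set.setOf_forall]
  refine (isClosed_iInter fun v => (isClosed_le ?_ ?_).inter (isClosed_le ?_ ?_)).inter
    (isClosed_iInter fun i => isClosed_iInter fun _ => isClosed_le ?_ ?_)
  all_goals fun_prop

/-- The set of tuples loosely matched to `pat` through `g` with gap `k` for SOME scale
`a ∈ [9/10, 1]` and SOME isometry `L` is closed. -/
theorem isClosed_looseMatchSet (θ : ℝ) (m : ℕ) (pat : Finset E3) (g : ↥pat → Fin m) (k : ℕ) :
    IsClosed {y : Fin m → E3 | ∃ p ∈ Set.Icc (9 / 10 : ℝ) 1 ×ˢ {L : E3 →L[ℝ] E3 | ∀ v, ‖L v‖ = ‖v‖},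
      (∀ v : ↥pat, ‖y (g v)‖ ≤ (5 / 4 - θ) * p.1 ∧
          dist (y (g v)) (p.2 (p.1 • (v : E3))) ≤ p.1 / 100 + θ) ∧
        ∀ i : Fin m, i ∉ Set.range g → (5 / 4 - θ) * p.1 + 1 / ((k : ℝ) + 1) ≤ ‖y i‖} :=
  isClosed_setOf_exists_mem_of_isCompact (isCompact_Icc.prod isCompact_iso)
    (isClosed_looseMatchRel θ m pat g k)

/-! ## Loose matching ⇔ loosened `ShellCloseTo` -/

/-- **Discretisation of the loosened `ShellCloseTo`.** For an injective tuple `y` of nonzero points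
and a scale `a > 0`: the `(5/4 − θ)a`-shell of `range y` is `(a/100 + θ)`-close to the scaled
pattern `a • pat` iff some injective assignment `g : pat → Fin m`, gap `k` and isometry `L`
loosely match. -/
theorem looseShell_iff_match (θ : ℝ) {m : ℕ} {y : Fin m → E3} (hy : Function.Injective y)
    (h0 : ∀ i, y i ≠ 0) (pat : Finset E3) {a : ℝ} (ha0 : 0 < a) :
    (∃ T : Finset E3, (↑T : Set E3) = {z : E3 | z ∈ Set.range y ∧ z ≠ 0 ∧ ‖z‖ ≤ (5 / 4 - θ) * a} ∧
        ShellCloseTo (a / 100 + θ) T (Finset.image (fun v : E3 => a • v) pat)) ↔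
      ∃ g : ↥pat → Fin m, Function.Injective g ∧ ∃ k : ℕ, ∃ L : E3 →L[ℝ] E3, (∀ v, ‖L v‖ = ‖v‖) ∧
        (∀ v : ↥pat, ‖y (g v)‖ ≤ (5 / 4 - θ) * a ∧ dist (y (g v)) (L (a • (v : E3))) ≤ a / 100 + θ) ∧
          ∀ i : Fin m, i ∉ Set.range g → (5 / 4 - θ) * a + 1 / ((k : ℝ) + 1) ≤ ‖y i‖ := by
  classical
  constructor
  · rintro ⟨T, hT, A, e, he⟩
    have hmemT : ∀ z : E3, z ∈ T ↔ z ∈ Set.range y ∧ z ≠ 0 ∧ ‖z‖ ≤ (5 / 4 - θ) * a := by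
      intro z
      rw [← Finset.mem_coe, hT]
      rfl
    -- index of a shell atom
    have hex : ∀ t : ↥T, ∃ i, y i = t := fun t => ((hmemT t).1 t.2).1
    choose idx hidx using hex
    have idx_inj : Function.Injective idx := fun t t' h =>
      Subtype.ext (by rw [← hidx t, ← hidx t', h])
    -- the rotated and scaled pattern
    have hqmem : ∀ v : ↥pat, A (a • (v : E3)) ∈ Finset.image (⇑A) (Finset.image (fun v : E3 => a • v) pat) :=
      fun v => Finset.mem_image_of_mem _ (Finset.mem_image_of_mem _ v.2)
    set qv : ↥pat → ↥(Finset.image (⇑A) (Finset.image (fun v : E3 => a • v) pat)) :=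
      fun v => ⟨A (a • (v : E3)), hqmem v⟩
    have qv_inj : Function.Injective qv := fun v w h =>
      Subtype.ext (smul_right_injective E3 ha0.ne' (A.injective (congrArg Subtype.val h)))
    set g : ↥pat → Fin m := fun v => idx (e.symm (qv v))
    have hyg : ∀ v, y (g v) = (e.symm (qv v) : E3) := fun v => hidx _
    have g_inj : Function.Injective g := fun v w h => qv_inj (e.symm.injective (idx_inj h))
    -- every shell atom is matched
    have hcover : ∀ i, ‖y i‖ ≤ (5 / 4 - θ) * a → i ∈ Set.range g := by
      intro i hi
      have hiT : y i ∈ T := (hmemT _).2 ⟨⟨i, rfl⟩, h0 i, hi⟩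
      obtain ⟨w, hw, hweq⟩ := Finset.mem_image.1 (e ⟨y i, hiT⟩).2
      obtain ⟨v, hv, rfl⟩ := Finset.mem_image.1 hw
      refine ⟨⟨v, hv⟩, hy ?_⟩
      have hq : qv ⟨v, hv⟩ = e ⟨y i, hiT⟩ := Subtype.ext hweq
      rw [hyg, hq, Equiv.symm_apply_apply]
    -- the gap of the unmatched atoms
    have hk : ∀ i, ∃ k : ℕ, i ∉ Set.range g → 1 / ((k : ℝ) + 1) ≤ ‖y i‖ - (5 / 4 - θ) * a := by
      intro i
      by_cases hi : i ∈ Set.range g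
      · exact ⟨0, fun h => absurd hi h⟩
      · have hgap : (5 / 4 - θ) * a < ‖y i‖ := lt_of_not_ge fun h => hi (hcover i h)
        obtain ⟨k, hk⟩ := exists_nat_one_div_lt (sub_pos.2 hgap)
        exact ⟨k, fun _ => hk.le⟩
    choose kf hkf using hk
    refine ⟨g, g_inj, Finset.univ.sup kf, A.toContinuousLinearMap, fun v => A.norm_map v,
      fun v => ⟨?_, ?_⟩, fun i hi => ?_⟩
    · have hmem : y (g v) ∈ T := by
        rw [hyg]
        exact (e.symm (qv v)).2
      exact ((hmemT _).1 hmem).2.2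
    · have hdist := he (e.symm (qv v))
      rw [Equiv.apply_symm_apply] at hdist
      rw [hyg]
      exact hdist
    · have h1 : 1 / (((Finset.univ.sup kf : ℕ) : ℝ) + 1) ≤ 1 / ((kf i : ℝ) + 1) := by
        apply one_div_le_one_div_of_le (by positivity)
        have : (kf i : ℝ) ≤ ((Finset.univ.sup kf : ℕ) : ℝ) := by
          exact_mod_cast Finset.le_sup (f := kf) (Finset.mem_univ i)
        linarith
      linarith [hkf i hi]
  · rintro ⟨g, hg, k, L, hL, hc1, hc2⟩
    set A : E3 →ₗᵢ[ℝ] E3 := ⟨(L : E3 →ₗ[ℝ] E3), hL⟩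
    have hAe : ∀ v : E3, A v = L v := fun v => rfl
    have hpos : (0 : ℝ) < 1 / ((k : ℝ) + 1) := by positivity
    refine ⟨Finset.univ.image fun v : ↥pat => y (g v), ?_, A, ?_⟩
    · ext z
      simp only [Finset.coe_image, Finset.coe_univ, Set.image_univ, Set.mem_range, Set.mem_setOf_eq]
      constructor
      · rintro ⟨v, rfl⟩
        exact ⟨⟨g v, rfl⟩, h0 _, (hc1 v).1⟩
      · rintro ⟨⟨i, rfl⟩, -, hle⟩
        by_cases hi : i ∈ Set.range g
        · obtain ⟨v, rfl⟩ := hi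
          exact ⟨v, rfl⟩
        · have := hc2 i hi
          linarith
    · refine etaMatched_of_param (ι := ↥pat) (f₁ := fun v => y (g v)) (f₂ := fun v => A (a • (v : E3)))
        (fun v => Finset.mem_image_of_mem _ (Finset.mem_univ v)) (hy.comp hg)
        (fun t ht => by simpa using ht)
        (fun v => Finset.mem_image_of_mem _ (Finset.mem_image_of_mem _ v.2))
        (fun v w h => Subtype.ext (smul_right_injective E3 ha0.ne' (A.injective h)))
        (fun q hq => ?_) (fun v => by rw [hAe]; exact (hc1 v).2)
      obtain ⟨w, hw, rfl⟩ := Finset.mem_image.1 hq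
      obtain ⟨v, hv, rfl⟩ := Finset.mem_image.1 hw
      exact ⟨⟨v, hv⟩, rfl⟩

/-! ## The Borel sets of loosely good tuples -/

/-- **The loosened shell condition (one pattern) on injective tuples of nonzero points is Borel**:
it is the countable union over `(g, k)` of the closed sets `isClosed_looseMatchSet`. -/
theorem exists_measurableSet_looseShellCloseTo (θ : ℝ) (m : ℕ) (pat : Finset E3) :
    ∃ G : Set (Fin m → E3), MeasurableSet G ∧ ∀ y : Fin m → E3, Function.Injective y → (∀ i, y i ≠ 0) →
      ((∃ a : ℝ, 9 / 10 ≤ a ∧ a ≤ 1 ∧ ∃ T : Finset E3,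
          (↑T : Set E3) = {z : E3 | z ∈ Set.range y ∧ z ≠ 0 ∧ ‖z‖ ≤ (5 / 4 - θ) * a} ∧
            ShellCloseTo (a / 100 + θ) T (Finset.image (fun v : E3 => a • v) pat)) ↔ y ∈ G) := by
  refine ⟨⋃ g : ↥pat → Fin m, ⋃ (_ : Function.Injective g), ⋃ k : ℕ,
      {y : Fin m → E3 | ∃ p ∈ Set.Icc (9 / 10 : ℝ) 1 ×ˢ {L : E3 →L[ℝ] E3 | ∀ v, ‖L v‖ = ‖v‖},
        (∀ v : ↥pat, ‖y (g v)‖ ≤ (5 / 4 - θ) * p.1 ∧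
            dist (y (g v)) (p.2 (p.1 • (v : E3))) ≤ p.1 / 100 + θ) ∧
          ∀ i : Fin m, i ∉ Set.range g → (5 / 4 - θ) * p.1 + 1 / ((k : ℝ) + 1) ≤ ‖y i‖},
    MeasurableSet.iUnion fun g => MeasurableSet.iUnion fun _ => MeasurableSet.iUnion fun k =>
      (isClosed_looseMatchSet θ m pat g k).measurableSet, fun y hy h0 => ?_⟩
  simp only [Set.mem_iUnion, Set.mem_setOf_eq, Set.mem_prod, Set.mem_Icc, exists_prop, Prod.exists]
  constructor
  · rintro ⟨a, ha1, ha2, hT⟩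
    obtain ⟨g, hg, k, L, hL, hc⟩ := (looseShell_iff_match θ hy h0 pat (by linarith)).1 hT
    exact ⟨g, hg, k, a, L, ⟨⟨ha1, ha2⟩, hL⟩, hc⟩
  · rintro ⟨g, hg, k, a, L, ⟨⟨ha1, ha2⟩, hL⟩, hc⟩
    exact ⟨a, ha1, ha2, (looseShell_iff_match θ hy h0 pat (by linarith)).2 ⟨g, hg, k, L, hL, hc⟩⟩

/-- **The loosened good-shell condition on injective tuples of nonzero points is Borel**
(FCC or HCP). -/
theorem exists_measurableSet_looseGoodShell (θ : ℝ) (m : ℕ) :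
    ∃ G : Set (Fin m → E3), MeasurableSet G ∧ ∀ y : Fin m → E3, Function.Injective y → (∀ i, y i ≠ 0) →
      (LooseGoodShell θ ((Measure.count : Measure E3).restrict (Set.range y)) ↔ y ∈ G) := by
  obtain ⟨G₁, hG₁, h₁⟩ := exists_measurableSet_looseShellCloseTo θ m fccKissingPattern
  obtain ⟨G₂, hG₂, h₂⟩ := exists_measurableSet_looseShellCloseTo θ m hcpKissingPattern
  refine ⟨G₁ ∪ G₂, hG₁.union hG₂, fun y hy h0 => ?_⟩
  rw [looseGoodShell_count_restrict_iff, Set.mem_union, ← h₁ y hy h0, ← h₂ y hy h0]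
  constructor
  · rintro ⟨a, ha1, ha2, T, hT, h | h⟩
    · exact Or.inl ⟨a, ha1, ha2, T, hT, h⟩
    · exact Or.inr ⟨a, ha1, ha2, T, hT, h⟩
  · rintro (⟨a, ha1, ha2, T, hT, h⟩ | ⟨a, ha1, ha2, T, hT, h⟩)
    · exact ⟨a, ha1, ha2, T, hT, Or.inl h⟩
    · exact ⟨a, ha1, ha2, T, hT, Or.inr h⟩

/-! ## The stub -/

/-- **stub_looseGoodShellMeasurable** (stub 2 of line `elastic-coarse-to-fine`, crux
`MinimiserShells`): for every `θ ≥ 0` the loosely-good-shell event is Giry-measurable modulo the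
hard-core class — some measurable set of configurations agrees with `LooseGoodShell θ` on every
rooted hard-core counting measure (for every hard-core radius `δ > 0`).  The set is the preimage
under `μ ↦ μ|𝕎` of the measurable set of finite configurations provided by the transfer theorem
for the property `Q F := F ⊆ 𝕎 ∧ LooseGoodShell θ (count|F)`. -/
theorem stub_looseGoodShellMeasurable :
    ∀ θ : ℝ, 0 ≤ θ →
      ∃ B : Set (Measure (EuclideanSpace ℝ (Fin 3))), MeasurableSet B ∧
        ∀ δ : ℝ, 0 < δ → ∀ μ : Measure (EuclideanSpace ℝ (Fin 3)), IsRootedHardCore δ μ →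
          (μ ∈ B ↔ LooseGoodShell θ μ) := by
  intro θ hθ
  have hQ : ∀ m : ℕ, ∃ G : Set (Fin m → E3), MeasurableSet G ∧ ∀ y : Fin m → E3, Function.Injective y →
      ((Set.range y ⊆ 𝕎 ∧ LooseGoodShell θ ((Measure.count : Measure E3).restrict (Set.range y))) ↔
        y ∈ G) := by
    intro m
    obtain ⟨G, hGm, hG⟩ := exists_measurableSet_looseGoodShell θ m
    refine ⟨{y : Fin m → E3 | ∀ i, y i ∈ 𝕎} ∩ G, (measurableSet_forall_mem_window m).inter hGm,
      fun y hy => ?_⟩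
    rw [Set.range_subset_iff, Set.mem_inter_iff, Set.mem_setOf_eq]
    exact ⟨fun ⟨hW, hg⟩ => ⟨hW, (hG y hy fun i => (hW i).1).1 hg⟩,
      fun ⟨hW, hg⟩ => ⟨hW, (hG y hy fun i => (hW i).1).2 hg⟩⟩
  obtain ⟨B, hB, hiff⟩ := exists_measurableSet_count_restrict_mem_iff
    (Q := fun F : Set E3 => F ⊆ 𝕎 ∧ LooseGoodShell θ ((Measure.count : Measure E3).restrict F)) hQ
  refine ⟨(fun μ : Measure E3 => μ.restrict 𝕎) ⁻¹' B, measurable_restrict_window hB, fun δ hδ μ hμ => ?_⟩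
  obtain ⟨S, -, hsep, rfl⟩ := hμ
  have hfin : (𝕎 ∩ S).Finite := by
    refine ((UniformlyDiscrete.finite_inter_closedBall ⟨δ, hδ, hsep⟩ 0 (5 / 4)).subset
      fun y hy => ⟨hy.2, ?_⟩)
    rw [Metric.mem_closedBall, dist_zero_right]
    exact hy.1.2
  rw [Set.mem_preimage, Measure.restrict_restrict measurableSet_window, hiff _ hfin,
    looseGoodShell_count_restrict_inter_window hθ]
  exact ⟨fun h => h.2, fun h => ⟨Set.inter_subset_left, h⟩⟩

end Summit.AtomisticToContinuum.Crystallization.Theorems.PalmUnimodularRigidityMinimiserShells.LooseGoodShellMeasurable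

end
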